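import Summits.QuantumFields.YangMills.Theorems.UnitScaleTiltProp7SymAvgRelativeAnalytic
import Summits.QuantumFields.YangMills.Theorems.UnitScaleTiltProp7AnalyticRemainderInputs
import HarnessLib

/-!
# Route `UnitScaleTilt`, crux K1 child «MinimiserStabilityRegPr» (stmt-QuantumFields-19200), stub `stub_existenceMinimalOrbit` (EX), route (α), node (AVG-SYM),
# row (46)∕M12, brick (T2) — **THE JOINT CHART OF THE k-FOLD (0.4) AVERAGE IN (PERTURBATION, BACKGROUND) IS ANALYTIC AND BOUNDED ON A JOINT SUP-BALL, HENCE
# ITS `A`-DERIVATIVE AT `A = 0` IS LIPSCHITZ IN THE BACKGROUND EXPONENT** (gauge-free, `P`-level, field-generic core of the covariant defect row (46-δ-cov)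
# «`QSym U₀` versus the block-axially transported flat `QSym 1`», ★★OWNER RULING M12 2026-08-28T03:46:59Z (T2)).

Cell `ym3-torus`, width seat `ym-ust-20520-w4` (gen 2).  YM₃ on T³ is a ladder rung (R3), NOT the Clay problem; nothing here is a claim about the stub, the crux, d = 4
or the mass gap.  `--supports stmt-QuantumFields-19200 --as helper`; count-neutral; def-free.

THE PRINT.  [Balaban1985Variational] (44)–(46) p. 285: the averaging in log coordinates `Q_j(ηA) = LʲηQ_jA + C_j(LʲηA)`, its linear part `Q_j` at the background
and a right inverse `H` with «|HB| ≤ B₀(Lʲη)⁻¹|B|»; [Balaban1985Averaging] (11)–(12) p. 19 (analyticity of the average in the bond variables), Prop. 4 p. 38.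
For the route's SYMMETRIC average the linear part at a CURVED background `U₀` must be compared with the flat one; since `U₀` is near `1` only after a block
axial gauge and only blockwise, the comparison is made through a complexified background exponent `B` (`U = e^{B}` on the two blocks read by the coarse bond).

WHAT THIS FILE PROVES (sorry-free, no definition; letters: `x = (A, B) : (PBond P 0 → 𝔸) × (PBond P 0 → 𝔸)` with the sup (product) norm, the JOINT FIELD
`b ↦ e^{A(b)}e^{B(b)}`, the BACKGROUND FIELD `b ↦ e^{B(b)}`, the JOINT CHART at a height-`k` bond `e`: `x ↦ log[Ū^{(k)}(e^{A}e^{B})(e)·(Ū^{(k)}(e^{B})(e))⁻¹]`,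
`ℓ := (d+2)L`, budget `6400ℓ²Lᵏ·(5ρ) ≤ 1`, `M₁ := 240ℓLᵏ·(5ρ)`).
* §0 `norm_fderiv_sub_fderiv_zero_le` — SCHWARZ: a map analytic on `ball 0 R` and bounded by `M` there has `‖f′(Y) − f′(0)‖ ≤ (16M∕R²)‖Y‖` for `‖Y‖ < R∕2`
  (★w2-20520 g2's `Prop7AnalyticRemainderInputs.norm_fderiv_le_of_bound` + `Complex.dist_le_div_mul_dist_of_mapsTo_ball`).
* §1 bondwise analyticity and reads of the joint∕background fields (`analyticAt_coe_jointCfg`, `analyticAt_coe_bgCfg`, `norm_coe_jointCfg_sub_one_le`, …).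
* §2 ★`analyticAt_jointChart` (p602756's field-generic `analyticAt_coe_emlIterU_family_of_reads` at the joint family + `B12Average012Analytic.analyticAt_units_inv` +
  `MatrixLog.analyticAt_mlog`), ★`norm_jointChart_le` (`≤ M₁`, by `norm_emlIterU_mul_inv_sub_one_le_of_reads` p599877 + `norm_mlog_le_two_mul`), `jointChart_flat_bg`
  (at `B = 0` the joint chart is the flat chart `A ↦ log Ū^{(k)}(e^{A})(e)`).
* §3 ★★**`norm_fderiv_slice_sub_fderiv_flat_le`** — for `‖B₀‖ < ρ∕2` and every `Y`:
  `‖∂_A|_{A=0} log[Ū^{(k)}(e^{A}e^{B₀})(e)·Ū^{(k)}(e^{B₀})(e)⁻¹]·Y − ∂_A|_{A=0} log[Ū^{(k)}(e^{A})(e)]·Y‖ ≤ (16M₁∕ρ²)·‖B₀‖·‖Y‖` (§0 at the joint chart, chain rule through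
  `A ↦ (A, B₀)`), and the differentiability of both slices at `0`.
HONEST SCOPE.  Bookkeeping over landed estimates; constants crude (`M₁∕ρ² ∝ Lᵏ∕ρ`); the T³∕`RegPr` reading (block axial gauge, `‖B₀‖ ≤ 36ε₀L^{−k}`, `ρ ∝ L^{−k}`,
hence a k-FREE coefficient of `Lᵏ‖Y‖`) is the companion file `…Prop7QSymCovDefectOfRegPr`.

References: T. Bałaban, CMP **102** (1985) 277–309 [Balaban1985Variational] ((44)–(46) p.285); CMP **98** (1985) 17–51 [Balaban1985Averaging] ((11)–(12) p.19,
Prop. 4 (134)–(135) p.38, Prop. 5 (157) p.42); CMP **109** (1987) 249–301 [Balaban1987RG1] ((0.4) p.253, (0.21) p.256).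
-/

noncomputable section

open scoped BigOperators
open NormedSpace Metric Set

namespace Summit.QuantumFields.YangMills.Theorems.Prop7SymAvgRelativeBound

open Literature.MathematicalPhysics.QuantumFieldTheory.Balaban1983to89
open T4Continuum BlockAveraging AveragingRT
open B5Eq118OneStroke (iterBlockOf)
open B7Prop1Explicit (expUnit val_expUnit norm_exp_sub_one_le_of_norm_le)
open MatrixLog (mlog mlog_one analyticAt_mlog norm_mlog_le_two_mul)
open B12Average012Analytic (analyticAt_units_inv)
open Summit.QuantumFields.YangMills.Theorems.Prop8Chart (emlIterU emlIterU_zero emlIterU_succ emlIterU_one norm_emlIterU_sub_one_le_of_reads)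
open Summit.QuantumFields.YangMills.Theorems.Prop7AnalyticRemainderInputs (norm_fderiv_le_of_bound)

variable {P : Params}

/-! ## §0 Schwarz: the derivative of a bounded analytic map is Lipschitz at the centre -/

section Schwarz

variable {𝒴 𝒳 : Type*} [NormedAddCommGroup 𝒴] [NormedSpace ℂ 𝒴] [NormedAddCommGroup 𝒳] [NormedSpace ℂ 𝒳]

/-- **SCHWARZ FOR THE DERIVATIVE**: a map analytic on `ball 0 R` and bounded by `M` there satisfies `‖f′(Y) − f′(0)‖ ≤ (16M∕R²)·‖Y‖` for `‖Y‖ < R∕2`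
(the derivative map is analytic on the half ball with values in the `8M∕R`-ball about `f′(0)` by the Cauchy bound `‖f′‖ ≤ 4M∕R`).
[cite: Balaban1985Averaging, Prop. 5 (157) p.42] -/
theorem norm_fderiv_sub_fderiv_zero_le [CompleteSpace 𝒳] {Ct : 𝒴 → 𝒳} {R M : ℝ} (hR : 0 < R)
    (han : AnalyticOnNhd ℂ Ct (ball (0 : 𝒴) R)) (hbd : ∀ Y ∈ ball (0 : 𝒴) R, ‖Ct Y‖ ≤ M)
    {Y : 𝒴} (hY : ‖Y‖ < R / 2) : ‖fderiv ℂ Ct Y - fderiv ℂ Ct 0‖ ≤ 16 * M / R ^ 2 * ‖Y‖ := by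
  have hM : 0 ≤ M := (norm_nonneg _).trans (hbd 0 (mem_ball_self hR))
  have hdiff : DifferentiableOn ℂ Ct (ball (0 : 𝒴) R) := han.differentiableOn
  have hF : DifferentiableOn ℂ (fderiv ℂ Ct) (ball (0 : 𝒴) (R / 2)) := by
    intro Z hZ
    have hZR : Z ∈ ball (0 : 𝒴) R := by
      rw [mem_ball_zero_iff] at hZ ⊢; linarith
    exact (han Z hZR).fderiv.differentiableAt.differentiableWithinAt
  have hmaps : MapsTo (fderiv ℂ Ct) (ball (0 : 𝒴) (R / 2)) (closedBall (fderiv ℂ Ct 0) (8 * M / R)) := by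
    intro Z hZ
    rw [mem_closedBall, dist_eq_norm]
    have h1 := norm_fderiv_le_of_bound hR hdiff hbd (mem_ball_zero_iff.1 hZ)
    have h2 := norm_fderiv_le_of_bound hR hdiff hbd (Y := (0 : 𝒴)) (by rw [norm_zero]; positivity)
    calc ‖fderiv ℂ Ct Z - fderiv ℂ Ct 0‖ ≤ ‖fderiv ℂ Ct Z‖ + ‖fderiv ℂ Ct 0‖ := norm_sub_le _ _
      _ ≤ 4 * M / R + 4 * M / R := add_le_add h1 h2
      _ = 8 * M / R := by ring
  have hYb : Y ∈ ball (0 : 𝒴) (R / 2) := mem_ball_zero_iff.2 hY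
  have hS := Complex.dist_le_div_mul_dist_of_mapsTo_ball hF hmaps hYb
  rw [dist_eq_norm, dist_eq_norm, sub_zero] at hS
  calc ‖fderiv ℂ Ct Y - fderiv ℂ Ct 0‖ ≤ 8 * M / R / (R / 2) * ‖Y‖ := hS
    _ = 16 * M / R ^ 2 * ‖Y‖ := by
        congr 1
        field_simp
        ring

end Schwarz

/-! ## §1 The joint field `e^{A}e^{B}` and the background field `e^{B}`: bondwise analyticity and reads -/

section Joint

variable {𝔸 : Type*} [NormedRing 𝔸] [NormedAlgebra ℂ 𝔸] [CompleteSpace 𝔸] [NormOneClass 𝔸]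

omit [NormOneClass 𝔸] in
/-- `e^0 = 1` as units. [folklore] -/
theorem expUnit_zero' : (expUnit (0 : 𝔸)) = 1 := by
  apply Units.ext
  rw [val_expUnit, exp_zero, Units.val_one]

omit [NormOneClass 𝔸] in
/-- `‖e^X − 1‖ ≤ 2‖X‖` for `‖X‖ ≤ 1`. [folklore] -/
theorem norm_exp_sub_one_le_two_mul_norm {X : 𝔸} (hX : ‖X‖ ≤ 1) : ‖exp X - 1‖ ≤ 2 * ‖X‖ := by
  have h1 : ‖exp X - 1‖ ≤ Real.exp ‖X‖ - 1 := (norm_exp_sub_one_le_of_norm_le le_rfl).1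
  have h2 : Real.exp ‖X‖ - 1 ≤ 2 * ‖X‖ := by
    have h := Real.abs_exp_sub_one_le (x := ‖X‖) (by rwa [abs_of_nonneg (norm_nonneg X)])
    rw [abs_of_nonneg (norm_nonneg X)] at h
    exact (le_abs_self _).trans h
  linarith

omit [NormOneClass 𝔸] in
/-- The bond exponent `x ↦ x.1 b` ∕ `x ↦ x.2 b` of the joint variable, exponentiated, is analytic. [cite: Balaban1985Averaging, (11)-(12) p.19] -/
theorem analyticAt_coe_expUnit_fst (b : PBond P 0) (x₀ : (PBond P 0 → 𝔸) × (PBond P 0 → 𝔸)) :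
    AnalyticAt ℂ (fun x : (PBond P 0 → 𝔸) × (PBond P 0 → 𝔸) => ((expUnit (x.1 b) : 𝔸ˣ) : 𝔸)) x₀ := by
  have hlin : AnalyticAt ℂ (fun x : (PBond P 0 → 𝔸) × (PBond P 0 → 𝔸) => x.1 b) x₀ :=
    ((ContinuousLinearMap.proj (R := ℂ) (φ := fun _ : PBond P 0 => 𝔸) b).comp
      (ContinuousLinearMap.fst ℂ (PBond P 0 → 𝔸) (PBond P 0 → 𝔸))).analyticAt x₀
  have hfun : (fun x : (PBond P 0 → 𝔸) × (PBond P 0 → 𝔸) => ((expUnit (x.1 b) : 𝔸ˣ) : 𝔸)) =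
      fun x => exp (x.1 b) := by
    funext x; rw [val_expUnit]
  rw [hfun]
  exact AnalyticAt.comp_of_eq (exp_analytic _) hlin rfl

omit [NormOneClass 𝔸] in
/-- Same for the second component. [cite: Balaban1985Averaging, (11)-(12) p.19] -/
theorem analyticAt_coe_expUnit_snd (b : PBond P 0) (x₀ : (PBond P 0 → 𝔸) × (PBond P 0 → 𝔸)) :
    AnalyticAt ℂ (fun x : (PBond P 0 → 𝔸) × (PBond P 0 → 𝔸) => ((expUnit (x.2 b) : 𝔸ˣ) : 𝔸)) x₀ := by
  have hlin : AnalyticAt ℂ (fun x : (PBond P 0 → 𝔸) × (PBond P 0 → 𝔸) => x.2 b) x₀ :=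
    ((ContinuousLinearMap.proj (R := ℂ) (φ := fun _ : PBond P 0 => 𝔸) b).comp
      (ContinuousLinearMap.snd ℂ (PBond P 0 → 𝔸) (PBond P 0 → 𝔸))).analyticAt x₀
  have hfun : (fun x : (PBond P 0 → 𝔸) × (PBond P 0 → 𝔸) => ((expUnit (x.2 b) : 𝔸ˣ) : 𝔸)) =
      fun x => exp (x.2 b) := by
    funext x; rw [val_expUnit]
  rw [hfun]
  exact AnalyticAt.comp_of_eq (exp_analytic _) hlin rfl

omit [NormOneClass 𝔸] in
/-- **THE JOINT FIELD `b ↦ e^{A(b)}e^{B(b)}` IS BONDWISE ANALYTIC IN `(A, B)`.** [cite: Balaban1985Averaging, (11)-(12) p.19] -/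
theorem analyticAt_coe_jointCfg (b : PBond P 0) (x₀ : (PBond P 0 → 𝔸) × (PBond P 0 → 𝔸)) :
    AnalyticAt ℂ (fun x : (PBond P 0 → 𝔸) × (PBond P 0 → 𝔸) => ((expUnit (x.1 b) * expUnit (x.2 b) : 𝔸ˣ) : 𝔸)) x₀ := by
  have hfun : (fun x : (PBond P 0 → 𝔸) × (PBond P 0 → 𝔸) => ((expUnit (x.1 b) * expUnit (x.2 b) : 𝔸ˣ) : 𝔸)) =
      fun x => ((expUnit (x.1 b) : 𝔸ˣ) : 𝔸) * ((expUnit (x.2 b) : 𝔸ˣ) : 𝔸) := by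
    funext x; rw [Units.val_mul]
  rw [hfun]
  exact (analyticAt_coe_expUnit_fst b x₀).mul (analyticAt_coe_expUnit_snd b x₀)

omit [NormOneClass 𝔸] in
/-- **READS OF THE BACKGROUND FIELD**: `‖e^{B(b)} − 1‖ ≤ 2ρ ≤ 5ρ` for `‖(A, B)‖ ≤ ρ ≤ 1∕4`. [folklore] -/
theorem norm_coe_bgCfg_sub_one_le {ρ : ℝ} (hρ : ρ ≤ 1 / 4) {x : (PBond P 0 → 𝔸) × (PBond P 0 → 𝔸)} (hx : ‖x‖ ≤ ρ) (b : PBond P 0) :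
    ‖((expUnit (x.2 b) : 𝔸ˣ) : 𝔸) - 1‖ ≤ 5 * ρ := by
  have hB : ‖x.2 b‖ ≤ ρ := (norm_le_pi_norm _ b).trans ((norm_snd_le x).trans hx)
  have hρ0 : 0 ≤ ρ := (norm_nonneg _).trans hB
  rw [val_expUnit]
  have h := norm_exp_sub_one_le_two_mul_norm (X := x.2 b) (by linarith)
  linarith

omit [NormOneClass 𝔸] in
/-- **READS OF THE JOINT FIELD**: `‖e^{A(b)}e^{B(b)} − 1‖ ≤ 5ρ` for `‖(A, B)‖ ≤ ρ ≤ 1∕4`. [folklore] -/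
theorem norm_coe_jointCfg_sub_one_le {ρ : ℝ} (hρ : ρ ≤ 1 / 4) {x : (PBond P 0 → 𝔸) × (PBond P 0 → 𝔸)} (hx : ‖x‖ ≤ ρ) (b : PBond P 0) :
    ‖((expUnit (x.1 b) * expUnit (x.2 b) : 𝔸ˣ) : 𝔸) - 1‖ ≤ 5 * ρ := by
  have hA : ‖x.1 b‖ ≤ ρ := (norm_le_pi_norm _ b).trans ((norm_fst_le x).trans hx)
  have hB : ‖x.2 b‖ ≤ ρ := (norm_le_pi_norm _ b).trans ((norm_snd_le x).trans hx)
  have hρ0 : 0 ≤ ρ := (norm_nonneg _).trans hB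
  have ha : ‖exp (x.1 b) - 1‖ ≤ 2 * ρ := (norm_exp_sub_one_le_two_mul_norm (X := x.1 b) (by linarith)).trans (by linarith)
  have hb : ‖exp (x.2 b) - 1‖ ≤ 2 * ρ := (norm_exp_sub_one_le_two_mul_norm (X := x.2 b) (by linarith)).trans (by linarith)
  rw [Units.val_mul, val_expUnit, val_expUnit]
  have e : exp (x.1 b) * exp (x.2 b) - 1 = (exp (x.1 b) - 1) * (exp (x.2 b) - 1) + (exp (x.1 b) - 1) + (exp (x.2 b) - 1) := by
    noncomm_ring
  rw [e]
  have hprod : ‖(exp (x.1 b) - 1) * (exp (x.2 b) - 1)‖ ≤ 2 * ρ * (2 * ρ) :=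
    (norm_mul_le _ _).trans (mul_le_mul ha hb (norm_nonneg _) (by positivity))
  calc _ ≤ ‖(exp (x.1 b) - 1) * (exp (x.2 b) - 1)‖ + ‖exp (x.1 b) - 1‖ + ‖exp (x.2 b) - 1‖ := norm_add₃_le
    _ ≤ 2 * ρ * (2 * ρ) + 2 * ρ + 2 * ρ := by linarith
    _ ≤ 5 * ρ := by nlinarith

/-! ## §2 The joint chart: analytic and bounded on the joint sup-ball -/

/-- From the budget: `ρ ≤ 1∕4` (indeed `32000ρ ≤ 1`). [folklore] -/
theorem rho_le_quarter_of_budget {k : ℕ} {ρ : ℝ} (hρ0 : 0 ≤ ρ)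
    (hbudget : 6400 * (((P.d + 2) * P.L : ℕ) : ℝ) ^ 2 * (P.L : ℝ) ^ k * (5 * ρ) ≤ 1) : ρ ≤ 1 / 4 := by
  have hℓ1 : (1 : ℝ) ≤ (((P.d + 2) * P.L : ℕ) : ℝ) := by
    exact_mod_cast Nat.one_le_iff_ne_zero.mpr (Nat.mul_ne_zero (by omega) (by have := P.hL.2; omega))
  have hL1 : (1 : ℝ) ≤ (P.L : ℝ) ^ k := one_le_pow₀ (by exact_mod_cast P.L_pos)
  have h1 : (1 : ℝ) ≤ (((P.d + 2) * P.L : ℕ) : ℝ) ^ 2 * (P.L : ℝ) ^ k := by nlinarith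
  nlinarith

/-- ★ **THE JOINT CHART IS ANALYTIC ON THE JOINT SUP-BALL**: under the budget `6400ℓ²Lᵏ(5ρ) ≤ 1`, at every `x₀ = (A₀, B₀)` with `‖x₀‖ ≤ ρ` the map
`x ↦ log[Ū^{(k)}(e^{A}e^{B})(e)·(Ū^{(k)}(e^{B})(e))⁻¹]` is analytic. [cite: Balaban1985Averaging, (11)-(12) p.19, Prop. 4 p.38; Balaban1987RG1, (0.4) p.253] -/
theorem analyticAt_jointChart {k : ℕ} (hk : k ≤ P.m + P.K) (e : PBond P k) {ρ : ℝ} (hρ0 : 0 ≤ ρ)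
    (hbudget : 6400 * (((P.d + 2) * P.L : ℕ) : ℝ) ^ 2 * (P.L : ℝ) ^ k * (5 * ρ) ≤ 1)
    (x₀ : (PBond P 0 → 𝔸) × (PBond P 0 → 𝔸)) (hx₀ : ‖x₀‖ ≤ ρ) :
    AnalyticAt ℂ (fun x : (PBond P 0 → 𝔸) × (PBond P 0 → 𝔸) =>
      mlog (((emlIterU k (fun b => expUnit (x.1 b) * expUnit (x.2 b)) e : 𝔸ˣ) : 𝔸) *
        (((emlIterU k (fun b => expUnit (x.2 b)) e)⁻¹ : 𝔸ˣ) : 𝔸))) x₀ := by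
  have hρ4 := rho_le_quarter_of_budget hρ0 hbudget
  set S : Set (Site P k) := {y | y = e.src ∨ y = e.tgt} with hS
  have hs : e.src ∈ S := Or.inl rfl
  have ht : e.tgt ∈ S := Or.inr rfl
  have h5 : 0 ≤ 5 * ρ := by positivity
  have hJ : AnalyticAt ℂ (fun x : (PBond P 0 → 𝔸) × (PBond P 0 → 𝔸) =>
      ((emlIterU k (fun b => expUnit (x.1 b) * expUnit (x.2 b)) e : 𝔸ˣ) : 𝔸)) x₀ :=
    analyticAt_coe_emlIterU_family_of_reads (fun x b => expUnit (x.1 b) * expUnit (x.2 b)) x₀ (fun b => analyticAt_coe_jointCfg b x₀)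
      k hk S (5 * ρ) h5 hbudget (fun b _ _ => norm_coe_jointCfg_sub_one_le hρ4 hx₀ b) e hs ht
  have hB : AnalyticAt ℂ (fun x : (PBond P 0 → 𝔸) × (PBond P 0 → 𝔸) => ((emlIterU k (fun b => expUnit (x.2 b)) e : 𝔸ˣ) : 𝔸)) x₀ :=
    analyticAt_coe_emlIterU_family_of_reads (fun x b => expUnit (x.2 b)) x₀ (fun b => analyticAt_coe_expUnit_snd b x₀)
      k hk S (5 * ρ) h5 hbudget (fun b _ _ => norm_coe_bgCfg_sub_one_le hρ4 hx₀ b) e hs ht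
  have hprod := hJ.mul (analyticAt_units_inv hB)
  have hrel : ‖((emlIterU k (fun b => expUnit (x₀.1 b) * expUnit (x₀.2 b)) e : 𝔸ˣ) : 𝔸) *
        (((emlIterU k (fun b => expUnit (x₀.2 b)) e)⁻¹ : 𝔸ˣ) : 𝔸) - 1‖ ≤ 120 * (((P.d + 2) * P.L : ℕ) : ℝ) * (P.L : ℝ) ^ k * (5 * ρ) :=
    norm_emlIterU_mul_inv_sub_one_le_of_reads hk S _ _ h5 hbudget (fun b _ _ => norm_coe_jointCfg_sub_one_le hρ4 hx₀ b)
      (fun b _ _ => norm_coe_bgCfg_sub_one_le hρ4 hx₀ b) e hs ht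
  have hℓ1 : (1 : ℝ) ≤ (((P.d + 2) * P.L : ℕ) : ℝ) := by
    exact_mod_cast Nat.one_le_iff_ne_zero.mpr (Nat.mul_ne_zero (by omega) (by have := P.hL.2; omega))
  have hlt : 120 * (((P.d + 2) * P.L : ℕ) : ℝ) * (P.L : ℝ) ^ k * (5 * ρ) < 1 := by
    have h0 : 0 ≤ (((P.d + 2) * P.L : ℕ) : ℝ) * (P.L : ℝ) ^ k * (5 * ρ) := by positivity
    nlinarith
  have hm : AnalyticAt ℂ (mlog : 𝔸 → 𝔸) (((emlIterU k (fun b => expUnit (x₀.1 b) * expUnit (x₀.2 b)) e : 𝔸ˣ) : 𝔸) *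
      (((emlIterU k (fun b => expUnit (x₀.2 b)) e)⁻¹ : 𝔸ˣ) : 𝔸)) := analyticAt_mlog (hrel.trans_lt hlt)
  exact hm.comp_of_eq hprod rfl

/-- ★ **THE JOINT CHART IS BOUNDED BY `M₁ = 240ℓLᵏ(5ρ)` ON THE JOINT SUP-BALL** (the relative iterate is within `120ℓLᵏ(5ρ) ≤ 1∕50` of `1`, then `|log X| ≤ 2|X − 1|`).
[cite: Balaban1985Averaging, Prop. 4 (134)-(135) p.38; Balaban1987RG1, (0.4) p.253] -/
theorem norm_jointChart_le {k : ℕ} (hk : k ≤ P.m + P.K) (e : PBond P k) {ρ : ℝ} (hρ0 : 0 ≤ ρ)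
    (hbudget : 6400 * (((P.d + 2) * P.L : ℕ) : ℝ) ^ 2 * (P.L : ℝ) ^ k * (5 * ρ) ≤ 1)
    (x : (PBond P 0 → 𝔸) × (PBond P 0 → 𝔸)) (hx : ‖x‖ ≤ ρ) :
    ‖mlog (((emlIterU k (fun b => expUnit (x.1 b) * expUnit (x.2 b)) e : 𝔸ˣ) : 𝔸) *
        (((emlIterU k (fun b => expUnit (x.2 b)) e)⁻¹ : 𝔸ˣ) : 𝔸))‖ ≤ 240 * (((P.d + 2) * P.L : ℕ) : ℝ) * (P.L : ℝ) ^ k * (5 * ρ) := by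
  have hρ4 := rho_le_quarter_of_budget hρ0 hbudget
  set S : Set (Site P k) := {y | y = e.src ∨ y = e.tgt} with hS
  have h5 : 0 ≤ 5 * ρ := by positivity
  have hrel : ‖((emlIterU k (fun b => expUnit (x.1 b) * expUnit (x.2 b)) e : 𝔸ˣ) : 𝔸) *
        (((emlIterU k (fun b => expUnit (x.2 b)) e)⁻¹ : 𝔸ˣ) : 𝔸) - 1‖ ≤ 120 * (((P.d + 2) * P.L : ℕ) : ℝ) * (P.L : ℝ) ^ k * (5 * ρ) :=
    norm_emlIterU_mul_inv_sub_one_le_of_reads hk S _ _ h5 hbudget (fun b _ _ => norm_coe_jointCfg_sub_one_le hρ4 hx b)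
      (fun b _ _ => norm_coe_bgCfg_sub_one_le hρ4 hx b) e (Or.inl rfl) (Or.inr rfl)
  have hℓ1 : (1 : ℝ) ≤ (((P.d + 2) * P.L : ℕ) : ℝ) := by
    exact_mod_cast Nat.one_le_iff_ne_zero.mpr (Nat.mul_ne_zero (by omega) (by have := P.hL.2; omega))
  have hhalf : 120 * (((P.d + 2) * P.L : ℕ) : ℝ) * (P.L : ℝ) ^ k * (5 * ρ) ≤ 1 / 2 := by
    have h0 : 0 ≤ (((P.d + 2) * P.L : ℕ) : ℝ) * (P.L : ℝ) ^ k * (5 * ρ) := by positivity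
    nlinarith
  calc _ ≤ 2 * ‖((emlIterU k (fun b => expUnit (x.1 b) * expUnit (x.2 b)) e : 𝔸ˣ) : 𝔸) *
        (((emlIterU k (fun b => expUnit (x.2 b)) e)⁻¹ : 𝔸ˣ) : 𝔸) - 1‖ := norm_mlog_le_two_mul (hrel.trans hhalf)
    _ ≤ _ := by linarith

omit [NormOneClass 𝔸] in
/-- **AT `B = 0` THE JOINT CHART IS THE FLAT CHART `A ↦ log Ū^{(k)}(e^{A})(e)`** (`e^{0} = 1`, `Ū^{(k)}(1) = 1`). [cite: Balaban1987RG1, (0.4) p.253] -/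
theorem jointChart_flat_bg {k : ℕ} (e : PBond P k) (A : PBond P 0 → 𝔸) :
    mlog (((emlIterU k (fun b => expUnit (((A, (0 : PBond P 0 → 𝔸)) : (PBond P 0 → 𝔸) × (PBond P 0 → 𝔸)).1 b) *
          expUnit (((A, (0 : PBond P 0 → 𝔸)) : (PBond P 0 → 𝔸) × (PBond P 0 → 𝔸)).2 b)) e : 𝔸ˣ) : 𝔸) *
        (((emlIterU k (fun b => expUnit (((A, (0 : PBond P 0 → 𝔸)) : (PBond P 0 → 𝔸) × (PBond P 0 → 𝔸)).2 b)) e)⁻¹ : 𝔸ˣ) : 𝔸)) =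
      mlog ((emlIterU k (fun b => expUnit (A b)) e : 𝔸ˣ) : 𝔸) := by
  have h1 : (fun b : PBond P 0 => expUnit (((A, (0 : PBond P 0 → 𝔸)) : (PBond P 0 → 𝔸) × (PBond P 0 → 𝔸)).1 b) *
      expUnit (((A, (0 : PBond P 0 → 𝔸)) : (PBond P 0 → 𝔸) × (PBond P 0 → 𝔸)).2 b)) = fun b => expUnit (A b) := by
    funext b
    simp only [Pi.zero_apply, expUnit_zero', mul_one]
  have h2 : (fun b : PBond P 0 => expUnit (((A, (0 : PBond P 0 → 𝔸)) : (PBond P 0 → 𝔸) × (PBond P 0 → 𝔸)).2 b)) =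
      fun _ => (1 : 𝔸ˣ) := by
    funext b
    simp only [Pi.zero_apply, expUnit_zero']
  rw [h1, h2, emlIterU_one k]
  simp

/-! ## §3 The `A`-derivative at `A = 0` is Lipschitz in the background exponent -/

/-- ★★ **THE LINEARISED AVERAGE AT THE BACKGROUND `e^{B₀}` VERSUS THE FLAT ONE — LIPSCHITZ IN `B₀`.**  Under the budget `6400ℓ²Lᵏ(5ρ) ≤ 1`, `0 < ρ`, for
`‖B₀‖ < ρ∕2` and every `Y`:
`‖∂_A|_{0} log[Ū^{(k)}(e^{A}e^{B₀})(e)·Ū^{(k)}(e^{B₀})(e)⁻¹]·Y − ∂_A|_{0} log[Ū^{(k)}(e^{A})(e)]·Y‖ ≤ (16M₁∕ρ²)·‖B₀‖·‖Y‖`, `M₁ = 240ℓLᵏ(5ρ)`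
(§0 at the joint chart between `(0, B₀)` and `0`, read on the vector `(Y, 0)`; chain rule through `A ↦ (A, B₀)`).
[cite: Balaban1985Variational, (44)-(46) p.285; Balaban1985Averaging, Prop. 4 p.38, Prop. 5 (157) p.42] -/
theorem norm_fderiv_slice_sub_fderiv_flat_le {k : ℕ} (hk : k ≤ P.m + P.K) (e : PBond P k) {ρ : ℝ} (hρ0 : 0 < ρ)
    (hbudget : 6400 * (((P.d + 2) * P.L : ℕ) : ℝ) ^ 2 * (P.L : ℝ) ^ k * (5 * ρ) ≤ 1)
    (B₀ : PBond P 0 → 𝔸) (hB₀ : ‖B₀‖ < ρ / 2) (Y : PBond P 0 → 𝔸) :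
    ‖fderiv ℂ (fun A : PBond P 0 → 𝔸 =>
          mlog (((emlIterU k (fun b => expUnit (A b) * expUnit (B₀ b)) e : 𝔸ˣ) : 𝔸) *
            (((emlIterU k (fun b => expUnit (B₀ b)) e)⁻¹ : 𝔸ˣ) : 𝔸))) 0 Y -
        fderiv ℂ (fun A : PBond P 0 → 𝔸 => mlog ((emlIterU k (fun b => expUnit (A b)) e : 𝔸ˣ) : 𝔸)) 0 Y‖ ≤
      16 * (240 * (((P.d + 2) * P.L : ℕ) : ℝ) * (P.L : ℝ) ^ k * (5 * ρ)) / ρ ^ 2 * ‖B₀‖ * ‖Y‖ := by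
  -- the joint chart, analytic and bounded on the (slightly larger) open ball of radius ρ
  set Ct : (PBond P 0 → 𝔸) × (PBond P 0 → 𝔸) → 𝔸 := fun x =>
    mlog (((emlIterU k (fun b => expUnit (x.1 b) * expUnit (x.2 b)) e : 𝔸ˣ) : 𝔸) *
      (((emlIterU k (fun b => expUnit (x.2 b)) e)⁻¹ : 𝔸ˣ) : 𝔸)) with hCt
  have han : AnalyticOnNhd ℂ Ct (ball (0 : (PBond P 0 → 𝔸) × (PBond P 0 → 𝔸)) ρ) := fun x hx =>
    analyticAt_jointChart hk e hρ0.le hbudget x (mem_ball_zero_iff.1 hx).le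
  have hbd : ∀ x ∈ ball (0 : (PBond P 0 → 𝔸) × (PBond P 0 → 𝔸)) ρ, ‖Ct x‖ ≤ 240 * (((P.d + 2) * P.L : ℕ) : ℝ) * (P.L : ℝ) ^ k * (5 * ρ) :=
    fun x hx => norm_jointChart_le hk e hρ0.le hbudget x (mem_ball_zero_iff.1 hx).le
  -- Schwarz between `(0, B₀)` and `0`
  have hnB : ‖((0 : PBond P 0 → 𝔸), B₀)‖ = ‖B₀‖ := by simp [Prod.norm_def]
  have hS := norm_fderiv_sub_fderiv_zero_le hρ0 han hbd (Y := ((0 : PBond P 0 → 𝔸), B₀)) (by rw [hnB]; exact hB₀)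
  rw [hnB] at hS
  -- the two slices through `A ↦ (A, B₀)` and `A ↦ (A, 0)`
  have hmemB : ((0 : PBond P 0 → 𝔸), B₀) ∈ ball (0 : (PBond P 0 → 𝔸) × (PBond P 0 → 𝔸)) ρ := by
    rw [mem_ball_zero_iff, hnB]; linarith
  have hmem0 : ((0 : PBond P 0 → 𝔸), (0 : PBond P 0 → 𝔸)) ∈ ball (0 : (PBond P 0 → 𝔸) × (PBond P 0 → 𝔸)) ρ := by
    rw [mem_ball_zero_iff]; simp [Prod.norm_def, hρ0]
  have hdB : HasFDerivAt Ct (fderiv ℂ Ct ((0 : PBond P 0 → 𝔸), B₀)) ((0 : PBond P 0 → 𝔸), B₀) :=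
    (han _ hmemB).differentiableAt.hasFDerivAt
  have hd0 : HasFDerivAt Ct (fderiv ℂ Ct ((0 : PBond P 0 → 𝔸), (0 : PBond P 0 → 𝔸))) ((0 : PBond P 0 → 𝔸), (0 : PBond P 0 → 𝔸)) :=
    (han _ hmem0).differentiableAt.hasFDerivAt
  have hinnerB : HasFDerivAt (fun A : PBond P 0 → 𝔸 => ((A, B₀) : (PBond P 0 → 𝔸) × (PBond P 0 → 𝔸)))
      (ContinuousLinearMap.inl ℂ (PBond P 0 → 𝔸) (PBond P 0 → 𝔸)) 0 := hasFDerivAt_prodMk_left (0 : PBond P 0 → 𝔸) B₀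
  have hinner0 : HasFDerivAt (fun A : PBond P 0 → 𝔸 => ((A, (0 : PBond P 0 → 𝔸)) : (PBond P 0 → 𝔸) × (PBond P 0 → 𝔸)))
      (ContinuousLinearMap.inl ℂ (PBond P 0 → 𝔸) (PBond P 0 → 𝔸)) 0 := hasFDerivAt_prodMk_left (0 : PBond P 0 → 𝔸) (0 : PBond P 0 → 𝔸)
  have hsliceB : HasFDerivAt (fun A : PBond P 0 → 𝔸 => Ct (A, B₀))
      ((fderiv ℂ Ct ((0 : PBond P 0 → 𝔸), B₀)).comp (ContinuousLinearMap.inl ℂ (PBond P 0 → 𝔸) (PBond P 0 → 𝔸))) 0 :=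
    HasFDerivAt.comp (f := fun A : PBond P 0 → 𝔸 => ((A, B₀) : (PBond P 0 → 𝔸) × (PBond P 0 → 𝔸))) (0 : PBond P 0 → 𝔸) hdB hinnerB
  have hslice0 : HasFDerivAt (fun A : PBond P 0 → 𝔸 => Ct (A, 0))
      ((fderiv ℂ Ct ((0 : PBond P 0 → 𝔸), (0 : PBond P 0 → 𝔸))).comp (ContinuousLinearMap.inl ℂ (PBond P 0 → 𝔸) (PBond P 0 → 𝔸))) 0 :=
    HasFDerivAt.comp (f := fun A : PBond P 0 → 𝔸 => ((A, (0 : PBond P 0 → 𝔸)) : (PBond P 0 → 𝔸) × (PBond P 0 → 𝔸))) (0 : PBond P 0 → 𝔸)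
      hd0 hinner0
  have hflat : (fun A : PBond P 0 → 𝔸 => Ct (A, 0)) = fun A => mlog ((emlIterU k (fun b => expUnit (A b)) e : 𝔸ˣ) : 𝔸) := by
    funext A; exact jointChart_flat_bg e A
  have hsliceB_eq : (fun A : PBond P 0 → 𝔸 =>
      mlog (((emlIterU k (fun b => expUnit (A b) * expUnit (B₀ b)) e : 𝔸ˣ) : 𝔸) *
        (((emlIterU k (fun b => expUnit (B₀ b)) e)⁻¹ : 𝔸ˣ) : 𝔸))) = fun A => Ct (A, B₀) := by
    funext A; rfl
  rw [hsliceB_eq, ← hflat, hsliceB.fderiv, hslice0.fderiv]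
  have hzero : ((0 : PBond P 0 → 𝔸), (0 : PBond P 0 → 𝔸)) = (0 : (PBond P 0 → 𝔸) × (PBond P 0 → 𝔸)) := rfl
  rw [hzero]
  rw [ContinuousLinearMap.comp_apply, ContinuousLinearMap.comp_apply, ContinuousLinearMap.inl_apply, ← sub_apply]
  have hnY : ‖(Y, (0 : PBond P 0 → 𝔸))‖ = ‖Y‖ := by simp [Prod.norm_def]
  calc ‖(fderiv ℂ Ct ((0 : PBond P 0 → 𝔸), B₀) - fderiv ℂ Ct 0) (Y, 0)‖
      ≤ ‖fderiv ℂ Ct ((0 : PBond P 0 → 𝔸), B₀) - fderiv ℂ Ct 0‖ * ‖(Y, (0 : PBond P 0 → 𝔸))‖ := ContinuousLinearMap.le_opNorm _ _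
    _ ≤ 16 * (240 * (((P.d + 2) * P.L : ℕ) : ℝ) * (P.L : ℝ) ^ k * (5 * ρ)) / ρ ^ 2 * ‖B₀‖ * ‖Y‖ := by
        rw [hnY]; exact mul_le_mul_of_nonneg_right hS (norm_nonneg _)

/-- **BOTH SLICES ARE DIFFERENTIABLE AT `0`** (so the `fderiv`s of §3 are honest derivatives): the background slice … -/
theorem differentiableAt_slice_zero {k : ℕ} (hk : k ≤ P.m + P.K) (e : PBond P k) {ρ : ℝ} (hρ0 : 0 < ρ)
    (hbudget : 6400 * (((P.d + 2) * P.L : ℕ) : ℝ) ^ 2 * (P.L : ℝ) ^ k * (5 * ρ) ≤ 1)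
    (B₀ : PBond P 0 → 𝔸) (hB₀ : ‖B₀‖ < ρ) :
    DifferentiableAt ℂ (fun A : PBond P 0 → 𝔸 =>
      mlog (((emlIterU k (fun b => expUnit (A b) * expUnit (B₀ b)) e : 𝔸ˣ) : 𝔸) *
        (((emlIterU k (fun b => expUnit (B₀ b)) e)⁻¹ : 𝔸ˣ) : 𝔸))) 0 := by
  have hnB : ‖((0 : PBond P 0 → 𝔸), B₀)‖ = ‖B₀‖ := by simp [Prod.norm_def]
  have han := analyticAt_jointChart hk e hρ0.le hbudget ((0 : PBond P 0 → 𝔸), B₀) (by rw [hnB]; exact hB₀.le)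
  have hinnerB : HasFDerivAt (fun A : PBond P 0 → 𝔸 => ((A, B₀) : (PBond P 0 → 𝔸) × (PBond P 0 → 𝔸)))
      (ContinuousLinearMap.inl ℂ (PBond P 0 → 𝔸) (PBond P 0 → 𝔸)) 0 := hasFDerivAt_prodMk_left (0 : PBond P 0 → 𝔸) B₀
  have hcomp := HasFDerivAt.comp (f := fun A : PBond P 0 → 𝔸 => ((A, B₀) : (PBond P 0 → 𝔸) × (PBond P 0 → 𝔸))) (0 : PBond P 0 → 𝔸)
    han.differentiableAt.hasFDerivAt hinnerB
  exact hcomp.differentiableAt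

/-- … and the flat slice. [cite: Balaban1987RG1, (0.4) p.253, (0.21) p.256] -/
theorem differentiableAt_flatChart_zero {k : ℕ} (hk : k ≤ P.m + P.K) (e : PBond P k) :
    DifferentiableAt ℂ (fun A : PBond P 0 → 𝔸 => mlog ((emlIterU k (fun b => expUnit (A b)) e : 𝔸ˣ) : 𝔸)) 0 := by
  -- the budget at some positive ρ: take `ρ := 1 ∕ (5 · 6400ℓ²Lᵏ)`
  set c : ℝ := 6400 * (((P.d + 2) * P.L : ℕ) : ℝ) ^ 2 * (P.L : ℝ) ^ k with hc
  have hℓ1 : (1 : ℝ) ≤ (((P.d + 2) * P.L : ℕ) : ℝ) := by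
    exact_mod_cast Nat.one_le_iff_ne_zero.mpr (Nat.mul_ne_zero (by omega) (by have := P.hL.2; omega))
  have hℓ0 : (0 : ℝ) < (((P.d + 2) * P.L : ℕ) : ℝ) := by linarith
  have hL0 : (0 : ℝ) < (P.L : ℝ) := by exact_mod_cast P.L_pos
  have hc0 : 0 < c := by rw [hc]; positivity
  set ρ : ℝ := 1 / (5 * c) with hρ
  have hρ0 : 0 < ρ := by rw [hρ]; exact div_pos one_pos (mul_pos (by norm_num) hc0)
  have hbudget : c * (5 * ρ) ≤ 1 := by
    rw [hρ, show c * (5 * (1 / (5 * c))) = 1 by field_simp]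
  have h := differentiableAt_slice_zero hk e hρ0 (by rw [← hc]; exact hbudget) (0 : PBond P 0 → 𝔸) (by rw [norm_zero]; exact hρ0)
  have hflat : (fun A : PBond P 0 → 𝔸 =>
      mlog (((emlIterU k (fun b => expUnit (A b) * expUnit ((0 : PBond P 0 → 𝔸) b)) e : 𝔸ˣ) : 𝔸) *
        (((emlIterU k (fun b => expUnit ((0 : PBond P 0 → 𝔸) b)) e)⁻¹ : 𝔸ˣ) : 𝔸))) =
      fun A => mlog ((emlIterU k (fun b => expUnit (A b)) e : 𝔸ˣ) : 𝔸) := by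
    funext A; exact jointChart_flat_bg e A
  rw [hflat] at h
  exact h

end Joint

end Summit.QuantumFields.YangMills.Theorems.Prop7SymAvgRelativeBound

end
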